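import Summits.Parity.GeneralizedHardyLittlewood.Theorems.FordMaynardNoSieveConst0164NegWitness0164Majorants
import Mathlib.Logic.Equiv.Fin.Basic

/-!
# Route `FordMaynardNoSieveConst0164`, crux `NegWitness0164` (stmt-Parity-19102), line `birth`,
# stub `stub_tweakNeg0164`: enclosure layer — pinning the two fixed coordinates of an α-family (II')

Helper file toward the certificate stub (K. Ford, J. Maynard, *On the theory of prime producing sieves*,
arXiv:2407.14368, §8).  In the second numerical target (II') of `stub_tweakNeg0164_of_numerics'` (`…J3Lower`) the sum
runs over all cell tuples `t : Fin 5 → Fin 24` while the last two coordinates of the vector `(v, b)` are the FIXED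
`b₀, b₁`.  If `b₀` lies in cell `i` and `b₁` in cell `j` (cells `[e_k, e_{k+1})`, `e_k = 41/250 + 7k/500`, are disjoint),
only the tuples `t = (t', i, j)` contribute, and the sum becomes a sum over `t' : Fin 3 → Fin 24` of purely
three-dimensional cell integrals — the form in which the α-families are bounded one cell triple at a time
(`…Majorants`).  This is the "family" discretisation of Ford–Maynard's `f_{2,1}(β₁, β₂, α)` (§8): the value depends on
`b` only through the cells of `b₀, b₁` and `α = 1 − b₀ − b₁`.

* `cell_unique_0164` — a real number lies in at most one cell;
* `family_pin_0164` — **`Σ_{t : Fin 5 → Fin 24} c(t)·∫_{Δ₃(α)} 𝟙[(v,b) ∈ cell t]/(v₀v₁v₂)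
   = Σ_{t' : Fin 3 → Fin 24} c(t', i, j)·∫_{Δ₃(α)} 𝟙[v ∈ cell t']/(v₀v₁v₂)`** for `b₀ ∈ cell i`, `b₁ ∈ cell j`
  (any coefficient table `c`, any `α`).

Def-free.  References: [FordMaynard2024PrimeSieves] arXiv:2407.14368, §8 (proof of Theorem 2.7 (c), `f_{2,1}`).
-/

noncomputable section

open Finset MeasureTheory Set
open scoped Classical
open Literature.NumberTheory.Sieve Literature.NumberTheory.Sieve.FordMaynard

namespace Summit.Parity.GeneralizedHardyLittlewood.FordMaynardNoSieveConst0164NegWitness0164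

/-- **Cells are disjoint**: if `x` lies in cell `g` and in cell `m` of the grid `e_k = 41/250 + 7k/500`, then `g = m`.
[folklore] -/
theorem cell_unique_0164 {g m : Fin 24} {x : ℝ}
    (h1 : (41 / 250 + (g : ℕ) * (7 / 500) : ℝ) ≤ x) (h2 : x < 41 / 250 + ((g : ℕ) + 1) * (7 / 500))
    (h3 : (41 / 250 + (m : ℕ) * (7 / 500) : ℝ) ≤ x) (h4 : x < 41 / 250 + ((m : ℕ) + 1) * (7 / 500)) : g = m := by
  have a1 : ((g : ℕ) : ℝ) < (m : ℕ) + 1 := by linarith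
  have a2 : ((m : ℕ) : ℝ) < (g : ℕ) + 1 := by linarith
  have b1 : (g : ℕ) < (m : ℕ) + 1 := by exact_mod_cast a1
  have b2 : (m : ℕ) < (g : ℕ) + 1 := by exact_mod_cast a2
  exact Fin.ext (by omega)

/-- **Pinning the fixed coordinates of an α-family.** For `b₀` in cell `i` and `b₁` in cell `j`, the five-index cell sum
of (II') collapses to a three-index sum over the cells of the free coordinates, with the table read at `(t', i, j)`.
[cite: FordMaynard2024PrimeSieves, §8 (proof of Theorem 2.7 (c), the families `f_{2,1}(β₁,β₂,α)`)] -/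
theorem family_pin_0164 (c : (Fin 5 → Fin 24) → ℝ) (α : ℝ) (b : Fin 2 → ℝ) (i j : Fin 24)
    (hb0 : (41 / 250 + (i : ℕ) * (7 / 500) : ℝ) ≤ b 0 ∧ b 0 < 41 / 250 + ((i : ℕ) + 1) * (7 / 500))
    (hb1 : (41 / 250 + (j : ℕ) * (7 / 500) : ℝ) ≤ b 1 ∧ b 1 < 41 / 250 + ((j : ℕ) + 1) * (7 / 500)) :
    ∑ t : Fin 5 → Fin 24, c t * sliceIntegral 3 α (fun v =>
        if ∀ k, (41 / 250 + (t k : ℕ) * (7 / 500) : ℝ) ≤ (Fin.append v b) k ∧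
          (Fin.append v b) k < 41 / 250 + ((t k : ℕ) + 1) * (7 / 500) then 1 / (v 0 * v 1 * v 2) else 0) =
    ∑ t : Fin 3 → Fin 24, c (Fin.append t ![i, j]) * sliceIntegral 3 α (fun v =>
        if ∀ k, (41 / 250 + (t k : ℕ) * (7 / 500) : ℝ) ≤ v k ∧ v k < 41 / 250 + ((t k : ℕ) + 1) * (7 / 500)
        then 1 / (v 0 * v 1 * v 2) else 0) := by
  -- the b-part of the cell condition holds exactly for the cell pair (i, j)
  have hbiff : ∀ g : Fin 2 → Fin 24,
      (∀ k : Fin 2, (41 / 250 + (g k : ℕ) * (7 / 500) : ℝ) ≤ b k ∧ b k < 41 / 250 + ((g k : ℕ) + 1) * (7 / 500)) ↔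
        g = ![i, j] := by
    intro g
    constructor
    · intro h
      have h0 := h 0
      have h1 := h 1
      have e0 : g 0 = i := cell_unique_0164 h0.1 h0.2 hb0.1 hb0.2
      have e1 : g 1 = j := cell_unique_0164 h1.1 h1.2 hb1.1 hb1.2
      funext k
      fin_cases k
      · simpa using e0
      · simpa using e1
    · rintro rfl k
      fin_cases k
      · simpa using hb0
      · simpa using hb1
  -- splitting the five-coordinate condition
  have hsplit : ∀ (f : Fin 3 → Fin 24) (g : Fin 2 → Fin 24) (v : Fin 3 → ℝ),
      (∀ k : Fin (3 + 2), (41 / 250 + ((Fin.append f g k : Fin 24) : ℕ) * (7 / 500) : ℝ) ≤ (Fin.append v b) k ∧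
        (Fin.append v b) k < 41 / 250 + (((Fin.append f g k : Fin 24) : ℕ) + 1) * (7 / 500)) ↔
      (∀ k : Fin 3, (41 / 250 + (f k : ℕ) * (7 / 500) : ℝ) ≤ v k ∧ v k < 41 / 250 + ((f k : ℕ) + 1) * (7 / 500)) ∧
      (∀ k : Fin 2, (41 / 250 + (g k : ℕ) * (7 / 500) : ℝ) ≤ b k ∧ b k < 41 / 250 + ((g k : ℕ) + 1) * (7 / 500)) := by
    intro f g v
    rw [Fin.forall_fin_add]
    simp only [Fin.append_left, Fin.append_right]
  -- reindex the sum over `(f, g)`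
  rw [← (Fin.appendEquiv 3 2).sum_comp, Fintype.sum_prod_type]
  refine Finset.sum_congr rfl fun f _ => ?_
  simp only [Fin.appendEquiv_apply]
  rw [Finset.sum_eq_single (![i, j] : Fin 2 → Fin 24)]
  · -- the surviving term
    congr 1
    congr 1
    funext v
    have hg : (![i, j] : Fin 2 → Fin 24) = ![i, j] := rfl
    by_cases hA : ∀ k : Fin 3, (41 / 250 + (f k : ℕ) * (7 / 500) : ℝ) ≤ v k ∧
        v k < 41 / 250 + ((f k : ℕ) + 1) * (7 / 500)
    · rw [if_pos hA, if_pos ((hsplit f _ v).mpr ⟨hA, (hbiff _).mpr hg⟩)]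
    · rw [if_neg hA, if_neg (fun h => hA ((hsplit f _ v).mp h).1)]
  · -- the other terms vanish
    intro g _ hg
    have hzero : (fun v : Fin 3 → ℝ =>
        if ∀ k : Fin (3 + 2), (41 / 250 + ((Fin.append f g k : Fin 24) : ℕ) * (7 / 500) : ℝ) ≤ (Fin.append v b) k ∧
          (Fin.append v b) k < 41 / 250 + (((Fin.append f g k : Fin 24) : ℕ) + 1) * (7 / 500)
        then 1 / (v 0 * v 1 * v 2) else 0) = fun _ => 0 := by
      funext v
      exact if_neg (fun h => hg ((hbiff g).mp ((hsplit f g v).mp h).2))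
    rw [hzero, sliceIntegral_zero, mul_zero]
  · intro h
    exact absurd (Finset.mem_univ _) h

end Summit.Parity.GeneralizedHardyLittlewood.FordMaynardNoSieveConst0164NegWitness0164

end
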